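import Literature.Analysis.InnerProduct.HigherLensSpaceSpectrum
import Literature.Analysis.InnerProduct.LensSpaceHeatTraceExpansion
import Mathlib.Analysis.Analytic.OfScalars
import Mathlib.Data.Nat.Choose.Bounds
import HarnessLib

/-!
# Ikeda–Yamamoto's generating function of a lens space `L(q : p₀, …, p_n) = S^{2n+1}/G` OF EVERY DIMENSION as a FUNCTION on
# the unit disc: Theorem 3.2 `F(z) = ∑_k dim E_{k(k+2n)}z^k = (1/q)∑_{l=0}^{q−1}(1 − z²)/∏_{i=0}^{n}(1 − γ^{pᵢl}z)(1 − γ^{−pᵢl}z)`,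
# the pole of order `2n+1` at `z = 1` with `lim_{z→1}(1−z)^{2n+1}F(z) = 2/q` (3.11), Proposition 3.1 (isospectral iff `F = E`)
# and COROLLARY 3.3 IN FULL GENERALITY: isospectral lens spaces (any `q`, any weights prime to `q`) have the same `q`

Layer `Literature/Analysis/InnerProduct`, namespace `Literature.Analysis.InnerProduct`; lane `lit-hodgefound`, prover seat
`lit-hodgefound-p06`, generation 44, self-proposed row g44-#7 — the every-dimension version of row g43-#4
(`LensSpaceGeneratingFunction.lean`, `n + 1 = 2`, whose architecture is followed line by line), the sequel BY IMPORT of rows g44-#1/#2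
(`HigherLensSpaceMultiplicity.lean`, `HigherLensSpaceSpectrum.lean`: `χ̃_k = sphereHarmonicCharacter n k`, `dim E_{k(k+2n)} =
lensSpaceMultiplicity q p k`, the multiplicity formula (3.10) `lensSpaceMultiplicity_eq_sum_sphereHarmonicCharacter`, Theorem 3.2
COEFFICIENTWISE `prod_quadratic_mul_mk_sphereHarmonicCharacter`: `∏ᵢ(1 − 2cᵢX + X²)·∑_kχ̃_k(c)X^k = 1 − X²` in `ℝ⟦X⟧`, and the trace
formula `sphereMonomialCharacter_cos`) and of row g43-#3 (`LensSpaceHeatTraceExpansion.lean`: `two_pi_mul_div_ne_of_isCoprime`). It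
removes the restriction of `HigherLensSpaceHeatTraceVolume.lean` (row g44-#6: Corollary 3.3 for Ikeda's families `𝓛̃₀(q, n)`, `q` prime,
via the heat trace): here `q ≥ 1` and the weights `pᵢ` are arbitrary integers prime to `q`, as printed. THEOREMS ONLY (no definition,
no instance, no notation, no named fact). Mathlib supplies the Cauchy product of absolutely convergent series
(`tsum_mul_tsum_eq_tsum_sum_antidiagonal_of_summable_norm`), `Polynomial ↪ PowerSeries`, the uniqueness of Taylor coefficients
(`HasFPowerSeriesAt.eq_formalMultilinearSeries` with `FormalMultilinearSeries.ofScalars`) and `Nat.choose_add_le_add_one_pow`.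

## Source, verbatim (held text `paper:doi-10-18910-4811`, pp. 452–453)

A. Ikeda, Y. Yamamoto, *On the spectra of 3-dimensional lens spaces*, Osaka J. Math. **16** (1979) 447–469 (§§1–3 treat
`L(q : p₀, ⋯, p_n) = S^{2n+1}/G` for every `n`): "Now, we consider the generating function `F(z)` associated to the infinite series
`{dim E_{k(k+2n)}}_{k=0}^{∞}`, i.e., (3.6) `F(z) = ∑_{k=0}^{∞}(dim E_{k(k+2n)})z^k`. By Corollary 1.4, the generating function `F(z)`
determines the spectrum of `L(q : p₀, ⋯, p_n)` … Now, consider another lens space `L(q' : p'₀, ⋯, p'_n)` and denote by `E(z)` the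
generating function associated to the spectrum of `L(q' : p'₀, ⋯, p'_n)`. Then we have **Proposition 3.1.** The lens space `L(q : p₀,
⋯, p_n)` is isospectral to `L(q' : p'₀, ⋯, p'_n)` if and only if (3.7) `F(z) = E(z)`. **Theorem 3.2.** Let `L(q : p₀, ⋯, p_n)` be a lens
space and `F(z)` the generating function associated to the spectrum of `L(q : p₀, ⋯, p_n)`. Then `F(z)` has the following form on the
domain `{z ∈ ℂ : |z| < 1}`: (3.8) `F(z) = (1/q)∑_{l=0}^{q−1}(1 − z²)/∏_{i=0}^{n}(1 − γ^{pᵢl}z)(1 − γ^{−pᵢl}z)`." (p0007); "`F(z)` can be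
considered as a meromorphic function on the whole complex plane `ℂ`. Any pole of `F(z)` is an `q`-th root of one. Especially, `F(z)`
has a pole of order `(2n+1)` at `z = 1`, and (3.11) `lim_{z→1}(1−z)^{2n+1}F(z) = 2/q`. Thus, we have proved **Corollary 3.3.** Assume
`L(q : p₀, ⋯, p_n)` is isospectral to `L(q' : p'₀, ⋯, p'_n)`. Then we have [`q = q'`]" (p0008; the conclusion as used in §4: "Then by
Corollary 3.3, we have `q = s`"). Here `γ = e^{2πi/q}`, `γ^{±pᵢl} = e^{±2πi·lpᵢ/q}`, the lens space has `n + 1` weights `p₀, …, p_n`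
prime to `q` (index type `Fin (n + 1)`), and "isospectral" = equal multiplicity functions `k ↦ dim E_{k(k+2n)}` (Corollary 2.3).

## The proof, as printed and as formalised

(3.9): `F(z) = (1/q)∑_l ∑_k (χ_k(g^l) − χ_{k−2}(g^l))z^k` by (3.10), and `∑_k χ̃_k(g^l)z^k = (1 − z²)∏ᵢ(1 − γ^{pᵢl}z)^{−1}(1 −
γ^{−pᵢl}z)^{−1}` by the formal expansion (3.4)–(3.5). Formally (§2): row g44-#2 proved `∏ᵢ(1 − 2cᵢX + X²)·∑_kχ̃_k(c)X^k = 1 − X²` in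
`ℝ⟦X⟧`; mapped to `ℂ⟦X⟧` and combined with the Cauchy product of the polynomial `∏ᵢ(1 − 2cᵢX + X²)` with the absolutely convergent
series `∑χ̃_k z^k` (§1: `|χ̃_k(cos φ)| ≤ 2·C(k+2n+1, 2n+1) ≤ 2(k+1)^{2n+1}` by the trace formula — `χ_k(cos φ)` is a sum of `dim P_k =
C(k+2n+1, 2n+1)` cosines) this gives `∏ᵢ(1 − 2cos φᵢz + z²)·∑_kχ̃_k z^k = 1 − z²` as NUMBERS for `|z| < 1`, and `(1 − e^{iφ}z)(1 −
e^{−iφ}z) = 1 − 2cos φ·z + z² ≠ 0` there; summing over `l` with (3.10) gives (3.8). §3: each `γ^{±pᵢl}` is a `q`-th root of unity, so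
for `z^q ≠ 1` no denominator vanishes (differentiability); for `pᵢ` prime to `q` and `0 < l < q`, `γ^{±pᵢl} ≠ 1`, so only the term
`l = 0`, `(1 − z²)/(1 − z)^{2n+2} = (1 + z)/(1 − z)^{2n+1}`, is singular at `z = 1`: `(1 − z)^{2n+1}F(z) → (1/q)·2`. Corollary 3.3: equal
multiplicities give equal power series, hence equal limits `2/q = 2/q'` along `z → 1` inside the disc. Proposition 3.1: "⇒" termwise;
"⇐" by uniqueness of the Taylor coefficients of a function holomorphic on the disc.

## What is proved

* §1: **`abs_sphereMonomialCharacter_cos_le`** (`|χ_k(cos φ)| ≤ C(k+2n+1, 2n+1) = dim P_k`), **`abs_sphereHarmonicCharacter_cos_le`**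
  (`|χ̃_k(cos φ)| ≤ 2·C(k+2n+1, 2n+1)`), `summable_norm_sphereHarmonicCharacter_mul_pow`; private tools (Cauchy product with a
  polynomial, `(1 − e^{iφ}z)(1 − e^{−iφ}z) = 1 − 2cos φ·z + z²`, nonvanishing on the disc, the `ℂ⟦X⟧` identity, uniqueness of
  coefficients on the unit disc) — copied from row g43-#4, where they are private.
* §2: **`hasSum_sphereHarmonicCharacter_mul_pow`** (one term of (3.8): `∑_kχ̃_k(cos φ)z^k = (1 − z²)/∏ᵢ(1 − e^{iφᵢ}z)(1 − e^{−iφᵢ}z)`),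
  **`hasSum_lensSpaceMultiplicity_mul_pow`** (THEOREM 3.2 (3.8), every `n`), `tsum_lensSpaceMultiplicity_mul_pow`,
  `summable_norm_lensSpaceMultiplicity_mul_pow`, **`lensSpaceMultiplicity_eq_iff_generatingFunction_eq`** (PROPOSITION 3.1).
* §3: **`differentiableAt_lensSpaceGeneratingFunction`** (poles only at `q`-th roots of unity),
  **`tendsto_one_sub_pow_mul_lensSpaceGeneratingFunction`** ((3.11) for the closed form, at `𝓝[≠] 1`),
  **`tendsto_one_sub_pow_mul_tsum_lensSpaceMultiplicity_mul_pow`** ((3.11) for the series, `z → 1` inside the disc),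
  **`eq_of_lensSpaceMultiplicity_eq`** (COROLLARY 3.3, EVERY DIMENSION, EVERY `q`: the spectrum of a lens space determines `q`).

## References

* [IkedaYamamoto1979] A. Ikeda, Y. Yamamoto, *On the spectra of 3-dimensional lens spaces*, Osaka J. Math. 16 (1979) 447–469,
  §2 Corollary 2.3, §3: (3.1), (3.4)–(3.6), Proposition 3.1 (3.7), Theorem 3.2 (3.8)–(3.10), (3.11), Corollary 3.3.
* [Ikeda1980] A. Ikeda, *On lens spaces which are isospectral but not isometric*, Ann. Sci. ÉNS (4) 13 (1980) 303–315, §2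
  (2.2)–(2.3) (the same generating function in dimension `2n − 1`).
-/

noncomputable section

open Finset Filter Topology Complex

namespace Literature.Analysis.InnerProduct

open _root_.Real _root_.Filter _root_.Topology _root_.Polynomial

/-! ### §1 Bounds `|χ_k(cos φ)| ≤ dim P_k`, `|χ̃_k(cos φ)| ≤ 2 dim P_k`; tools -/

/-- **`|χ_k(cos φ₀, …, cos φ_n)| ≤ C(k+2n+1, 2n+1) = dim P_k`**: by the trace formula `χ_k(cos φ) = ∑_{|x|=k}∑_{aᵢ+bᵢ=xᵢ}
cos(∑ᵢ(aᵢ−bᵢ)φᵢ)` (`sphereMonomialCharacter_cos`) — a sum of `dim P_k` cosines (`lensSpaceMonomialCount_one_left`). [cite: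
IkedaYamamoto1979, §3 (3.2)–(3.4) (`χ_k` is the character of `P_k`, `dim P_k` terms of modulus `1`)] -/
theorem abs_sphereMonomialCharacter_cos_le {n : ℕ} (k : ℕ) (φ : Fin (n + 1) → ℝ) :
    |sphereMonomialCharacter (n + 1) k (fun i ↦ Real.cos (φ i))| ≤ ((k + 2 * n + 1).choose (2 * n + 1) : ℝ) := by
  rw [sphereMonomialCharacter_cos, ← lensSpaceMonomialCount_one_left (fun _ : Fin (n + 1) ↦ (0 : ℤ)) k]
  unfold lensSpaceMonomialCount
  simp only [Nat.cast_sum, Nat.cast_one, mul_zero, Finset.sum_const_zero, dvd_zero, if_true]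
  refine (Finset.abs_sum_le_sum_abs _ _).trans (Finset.sum_le_sum fun x _ ↦ ?_)
  refine (Finset.abs_sum_le_sum_abs _ _).trans (Finset.sum_le_sum fun e _ ↦ ?_)
  exact Real.abs_cos_le_one _

/-- **`|χ̃_k(cos φ)| ≤ 2·C(k+2n+1, 2n+1)`** (`χ̃_k = χ_k − χ_{k−2}`, `dim P_{k−2} ≤ dim P_k`). [cite: IkedaYamamoto1979, §3 (3.1)] -/
theorem abs_sphereHarmonicCharacter_cos_le {n : ℕ} (k : ℕ) (φ : Fin (n + 1) → ℝ) :
    |sphereHarmonicCharacter (n + 1) k (fun i ↦ Real.cos (φ i))| ≤ 2 * ((k + 2 * n + 1).choose (2 * n + 1) : ℝ) := by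
  rw [sphereHarmonicCharacter_eq]
  have h1 := abs_sphereMonomialCharacter_cos_le k φ
  have h0 : (0 : ℝ) ≤ ((k + 2 * n + 1).choose (2 * n + 1) : ℝ) := Nat.cast_nonneg _
  split_ifs with hk
  · have h2 := abs_sphereMonomialCharacter_cos_le (k - 2) φ
    have h3 : (((k - 2 + 2 * n + 1).choose (2 * n + 1) : ℕ) : ℝ) ≤ ((k + 2 * n + 1).choose (2 * n + 1) : ℝ) := by
      exact_mod_cast Nat.choose_le_choose _ (by omega)
    calc _ ≤ |sphereMonomialCharacter (n + 1) k (fun i ↦ Real.cos (φ i))| +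
          |sphereMonomialCharacter (n + 1) (k - 2) (fun i ↦ Real.cos (φ i))| := abs_sub _ _
      _ ≤ _ := by linarith
  · rw [sub_zero]
    linarith

/-- `|χ̃_k(cos φ)z^k| ≤ 2(k+1)^{2n+1}|z|^k` is summable for `|z| < 1` (`C(k+2n+1, 2n+1) ≤ (k+1)^{2n+1}`). [cite: IkedaYamamoto1979,
Theorem 3.2 ("on the domain `{z ∈ ℂ : |z| < 1}`")] -/
theorem summable_norm_sphereHarmonicCharacter_mul_pow {n : ℕ} (φ : Fin (n + 1) → ℝ) {z : ℂ} (hz : ‖z‖ < 1) :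
    Summable fun k : ℕ ↦ ‖(sphereHarmonicCharacter (n + 1) k (fun i ↦ Real.cos (φ i)) : ℂ) * z ^ k‖ := by
  have hr : ‖(‖z‖ : ℝ)‖ < 1 := by rwa [Real.norm_of_nonneg (norm_nonneg z)]
  have h1 : Summable fun k : ℕ ↦ ((k : ℝ) ^ (2 * n + 1) * ‖z‖ ^ k) := summable_pow_mul_geometric_of_norm_lt_one (2 * n + 1) hr
  have h2 : Summable fun k : ℕ ↦ ‖z‖ ^ k := summable_geometric_of_lt_one (norm_nonneg _) hz
  refine .of_nonneg_of_le (fun k ↦ norm_nonneg _) (fun k ↦ ?_)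
    ((h1.mul_left (2 * 2 ^ (2 * n + 1))).add (h2.mul_left (2 * 2 ^ (2 * n + 1))))
  rw [norm_mul, norm_pow, Complex.norm_real, Real.norm_eq_abs]
  have hb := abs_sphereHarmonicCharacter_cos_le k φ
  have hc : ((k + 2 * n + 1).choose (2 * n + 1) : ℝ) ≤ ((k : ℝ) + 1) ^ (2 * n + 1) := by
    have h := Nat.choose_add_le_add_one_pow k (2 * n + 1)
    rw [show k + (2 * n + 1) = k + 2 * n + 1 by ring] at h
    exact_mod_cast h
  have hk : ((k : ℝ) + 1) ^ (2 * n + 1) ≤ 2 ^ (2 * n + 1) * (k : ℝ) ^ (2 * n + 1) + 2 ^ (2 * n + 1) := by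
    rcases Nat.eq_zero_or_pos k with rfl | hk
    · simpa using (one_le_pow₀ (by norm_num : (1 : ℝ) ≤ 2) : (1 : ℝ) ≤ 2 ^ (2 * n + 1))
    · have hk1 : (1 : ℝ) ≤ k := Nat.one_le_cast.mpr hk
      have h3 : ((k : ℝ) + 1) ^ (2 * n + 1) ≤ (2 * k) ^ (2 * n + 1) := pow_le_pow_left₀ (by positivity) (by linarith) _
      rw [mul_pow] at h3
      have h4 : (0 : ℝ) ≤ 2 ^ (2 * n + 1) := by positivity
      linarith
  have hzk : 0 ≤ ‖z‖ ^ k := pow_nonneg (norm_nonneg _) _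
  calc |sphereHarmonicCharacter (n + 1) k (fun i ↦ Real.cos (φ i))| * ‖z‖ ^ k
      ≤ 2 * (2 ^ (2 * n + 1) * (k : ℝ) ^ (2 * n + 1) + 2 ^ (2 * n + 1)) * ‖z‖ ^ k :=
        mul_le_mul_of_nonneg_right (hb.trans (by linarith)) hzk
    _ = 2 * 2 ^ (2 * n + 1) * ((k : ℝ) ^ (2 * n + 1) * ‖z‖ ^ k) + 2 * 2 ^ (2 * n + 1) * ‖z‖ ^ k := by ring

/-- **Cauchy product of a polynomial `P` with an absolutely convergent power series** `∑ s_k z^k`: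
`∑_n [Xⁿ](P·∑ s_kX^k)·zⁿ = P(z)·∑_k s_k z^k`. [folklore] -/
private theorem hasSum_coeff_coe_mul_mk_mul_pow (P : ℂ[X]) {s : ℕ → ℂ} {z : ℂ}
    (hs : Summable fun k : ℕ ↦ ‖s k * z ^ k‖) :
    HasSum (fun n : ℕ ↦ PowerSeries.coeff n ((P : PowerSeries ℂ) * PowerSeries.mk s) * z ^ n)
      (P.eval z * ∑' k : ℕ, s k * z ^ k) := by
  set f : ℕ → ℂ := fun i ↦ P.coeff i * z ^ i with hf_def
  have hf0 : ∀ i ∉ P.support, f i = 0 := fun i hi ↦ by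
    rw [hf_def]
    simp only [Polynomial.notMem_support_iff.mp hi, zero_mul]
  have hfn : Summable fun i ↦ ‖f i‖ :=
    summable_of_ne_finset_zero (s := P.support) fun i hi ↦ by rw [hf0 i hi, norm_zero]
  have hfsum : ∑' i, f i = P.eval z := by
    rw [(hasSum_sum_of_ne_finset_zero hf0).tsum_eq, Polynomial.eval_eq_sum, Polynomial.sum_def]
  have hprod := tsum_mul_tsum_eq_tsum_sum_antidiagonal_of_summable_norm hfn hs
  have hsum : Summable fun n : ℕ ↦ ∑ kl ∈ antidiagonal n, f kl.1 * (s kl.2 * z ^ kl.2) :=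
    (summable_norm_sum_mul_antidiagonal_of_summable_norm hfn hs).of_norm
  have key : (fun n : ℕ ↦ ∑ kl ∈ antidiagonal n, f kl.1 * (s kl.2 * z ^ kl.2)) =
      fun n : ℕ ↦ PowerSeries.coeff n ((P : PowerSeries ℂ) * PowerSeries.mk s) * z ^ n := by
    funext n
    rw [PowerSeries.coeff_mul, Finset.sum_mul]
    refine Finset.sum_congr rfl fun kl hkl ↦ ?_
    rw [Polynomial.coeff_coe, PowerSeries.coeff_mk, hf_def, ← mem_antidiagonal.mp hkl, pow_add]
    ring
  have h := hsum.hasSum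
  rwa [← hprod, hfsum, key] at h

/-- `(1 − e^{iφ}z)(1 − e^{−iφ}z) = 1 − 2cos φ·z + z²`. [folklore] -/
private theorem one_sub_exp_mul_mul_one_sub_exp_neg_mul (φ : ℝ) (z : ℂ) :
    (1 - cexp (φ * I) * z) * (1 - cexp (-φ * I) * z) = 1 - 2 * (Real.cos φ : ℂ) * z + z ^ 2 := by
  have h1 : cexp (φ * I) * cexp (-φ * I) = 1 := by rw [← Complex.exp_add]; simp
  have h2 : cexp (φ * I) + cexp (-φ * I) = 2 * (Real.cos φ : ℂ) := by rw [Complex.ofReal_cos, Complex.two_cos]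
  linear_combination (-z) * h2 + z ^ 2 * h1

/-- `1 − e^{ix}z ≠ 0` for `|z| < 1`. [folklore] -/
private theorem one_sub_exp_mul_mul_ne_zero (x : ℝ) {z : ℂ} (hz : ‖z‖ < 1) : 1 - cexp (x * I) * z ≠ 0 := by
  intro h
  have h1 := congrArg (‖·‖) (sub_eq_zero.mp h)
  simp only [norm_one, norm_mul, Complex.norm_exp_ofReal_mul_I, one_mul] at h1
  linarith

/-- `1 − e^{−ix}z ≠ 0` for `|z| < 1`. [folklore] -/
private theorem one_sub_exp_neg_mul_mul_ne_zero (x : ℝ) {z : ℂ} (hz : ‖z‖ < 1) : 1 - cexp (-x * I) * z ≠ 0 := by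
  have h := one_sub_exp_mul_mul_ne_zero (-x) hz
  push_cast at h
  exact h

/-- `∏ᵢ(1 − e^{iφᵢ}z)(1 − e^{−iφᵢ}z) ≠ 0` for `|z| < 1`. [folklore] -/
private theorem prod_one_sub_exp_mul_ne_zero {n : ℕ} (φ : Fin n → ℝ) {z : ℂ} (hz : ‖z‖ < 1) :
    ∏ i, ((1 - cexp (φ i * I) * z) * (1 - cexp (-(φ i) * I) * z)) ≠ 0 :=
  Finset.prod_ne_zero_iff.mpr fun i _ ↦
    mul_ne_zero (one_sub_exp_mul_mul_ne_zero (φ i) hz) (one_sub_exp_neg_mul_mul_ne_zero (φ i) hz)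

/-- The polynomial `∏ᵢ(1 − 2cᵢX + X²) ∈ ℂ[X]` as a power series, times `∑ χ̃_k(c)X^k`, is `1 − X²` (Theorem 3.2 coefficientwise,
`HigherLensSpaceSpectrum.prod_quadratic_mul_mk_sphereHarmonicCharacter`, mapped from `ℝ⟦X⟧` to `ℂ⟦X⟧`). [cite: IkedaYamamoto1979,
Theorem 3.2 (3.8)–(3.9)] -/
private theorem coe_prod_quadratic_mul_mk_sphereHarmonicCharacter {n : ℕ} (c : Fin n → ℝ) :
    (((∏ i, (1 - Polynomial.C (2 * (c i : ℂ)) * Polynomial.X + Polynomial.X ^ 2) : ℂ[X])) : PowerSeries ℂ) *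
      PowerSeries.mk (fun k : ℕ ↦ (sphereHarmonicCharacter n k c : ℂ)) = 1 - PowerSeries.X ^ 2 := by
  have h := congrArg (PowerSeries.map Complex.ofRealHom) (prod_quadratic_mul_mk_sphereHarmonicCharacter c)
  have hquad : ∀ c : ℝ, PowerSeries.map Complex.ofRealHom
      ((1 : PowerSeries ℝ) - PowerSeries.C (2 * c) * PowerSeries.X + PowerSeries.X ^ 2) =
      (((1 - Polynomial.C (2 * (c : ℂ)) * Polynomial.X + Polynomial.X ^ 2 : ℂ[X])) : PowerSeries ℂ) := fun c ↦ by
    rw [map_add, map_sub, map_one, map_mul, PowerSeries.map_C, PowerSeries.map_X, map_pow, PowerSeries.map_X,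
      Polynomial.coe_add, Polynomial.coe_sub, Polynomial.coe_one, Polynomial.coe_mul, Polynomial.coe_pow,
      Polynomial.coe_C, Polynomial.coe_X]
    simp
  have hmk : PowerSeries.map Complex.ofRealHom (PowerSeries.mk fun k : ℕ ↦ sphereHarmonicCharacter n k c) =
      PowerSeries.mk fun k : ℕ ↦ (sphereHarmonicCharacter n k c : ℂ) := by
    ext k
    simp [PowerSeries.coeff_map]
  have hprod : PowerSeries.map Complex.ofRealHom (∏ i, ((1 : PowerSeries ℝ) - PowerSeries.C (2 * c i) * PowerSeries.X + PowerSeries.X ^ 2)) =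
      (((∏ i, (1 - Polynomial.C (2 * (c i : ℂ)) * Polynomial.X + Polynomial.X ^ 2) : ℂ[X])) : PowerSeries ℂ) := by
    rw [map_prod, ← Polynomial.coeToPowerSeries.ringHom_apply, map_prod]
    exact Finset.prod_congr rfl fun i _ ↦ by rw [hquad, Polynomial.coeToPowerSeries.ringHom_apply]
  rw [map_mul, hprod, hmk, map_sub, map_one, map_pow, PowerSeries.map_X] at h
  exact h

/-- **A power series converging absolutely on the unit disc is determined by its sum there** (uniqueness of Taylor
coefficients, via Mathlib's `HasFPowerSeriesAt.eq_formalMultilinearSeries`). [folklore] -/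
private theorem eq_of_tsum_mul_pow_eq {a b : ℕ → ℂ} (ha : ∀ z : ℂ, ‖z‖ < 1 → Summable fun k : ℕ ↦ ‖a k * z ^ k‖)
    (hb : ∀ z : ℂ, ‖z‖ < 1 → Summable fun k : ℕ ↦ ‖b k * z ^ k‖)
    (h : ∀ z : ℂ, ‖z‖ < 1 → ∑' k : ℕ, a k * z ^ k = ∑' k : ℕ, b k * z ^ k) : a = b := by
  have hps : ∀ {c : ℕ → ℂ}, (∀ z : ℂ, ‖z‖ < 1 → Summable fun k : ℕ ↦ ‖c k * z ^ k‖) →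
      HasFPowerSeriesOnBall (fun z : ℂ ↦ ∑' k : ℕ, c k * z ^ k) (FormalMultilinearSeries.ofScalars ℂ c) 0 1 := by
    intro c hc
    refine ⟨?_, one_pos, fun {y} hy ↦ ?_⟩
    · refine ENNReal.le_of_forall_nnreal_lt fun r hr ↦ FormalMultilinearSeries.le_radius_of_summable _ ?_
      have hr' : ‖(r : ℂ)‖ < 1 := by
        rw [Complex.norm_real, NNReal.norm_eq]
        exact_mod_cast hr
      refine (hc r hr').congr fun n ↦ ?_
      rw [FormalMultilinearSeries.ofScalars_norm_eq_mul, ContinuousMultilinearMap.norm_mkPiAlgebraFin, mul_one,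
        norm_mul, norm_pow, Complex.norm_real, NNReal.norm_eq]
    · have hy' : ‖y‖ < 1 := by
        rwa [mem_eball_zero_iff, ← ofReal_norm, ENNReal.ofReal_lt_one] at hy
      simp only [FormalMultilinearSeries.ofScalars_apply_eq, smul_eq_mul, zero_add]
      exact (hc y hy').of_norm.hasSum
  have hfa := (hps ha).hasFPowerSeriesAt
  have hfb := (hps hb).hasFPowerSeriesAt
  have heq : (fun z : ℂ ↦ ∑' k : ℕ, a k * z ^ k) =ᶠ[𝓝 0] fun z : ℂ ↦ ∑' k : ℕ, b k * z ^ k := by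
    filter_upwards [Metric.ball_mem_nhds (0 : ℂ) one_pos] with z hz
    exact h z (mem_ball_zero_iff.mp hz)
  have hp := (hfa.congr heq).eq_formalMultilinearSeries hfb
  funext n
  have := congrArg (fun p : FormalMultilinearSeries ℂ ℂ ℂ ↦ p n fun _ ↦ 1) hp
  simpa [FormalMultilinearSeries.ofScalars_apply_eq] using this

/-! ### §2 Theorem 3.2: the generating function `F(z) = ∑_k dim E_{k(k+2n)}·z^k` on the unit disc, every `n` -/

/-- **One term of (3.8), every dimension**: for `|z| < 1`, `∑_k χ̃_k(cos φ₀, …, cos φ_n)z^k = (1 − z²)/∏ᵢ(1 − e^{iφᵢ}z)(1 − e^{−iφᵢ}z)`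
— the character of `⊕_k H_k z^k` on `S^{2n+1}` at the torus element `diag(e^{iφ₀}, …, e^{iφ_n})` ((3.1), (3.4)–(3.5), the step (3.9)).
[cite: IkedaYamamoto1979, §3 (3.1), (3.4)–(3.5), proof of Theorem 3.2 (3.9)] -/
theorem hasSum_sphereHarmonicCharacter_mul_pow {n : ℕ} (φ : Fin (n + 1) → ℝ) {z : ℂ} (hz : ‖z‖ < 1) :
    HasSum (fun k : ℕ ↦ (sphereHarmonicCharacter (n + 1) k (fun i ↦ Real.cos (φ i)) : ℂ) * z ^ k)
      ((1 - z ^ 2) / ∏ i, ((1 - cexp (φ i * I) * z) * (1 - cexp (-(φ i) * I) * z))) := by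
  have hs := summable_norm_sphereHarmonicCharacter_mul_pow φ hz
  have h1 := hasSum_coeff_coe_mul_mk_mul_pow (∏ i, (1 - Polynomial.C (2 * (Real.cos (φ i) : ℂ)) * Polynomial.X + Polynomial.X ^ 2)) hs
  rw [coe_prod_quadratic_mul_mk_sphereHarmonicCharacter] at h1
  have h2 : HasSum (fun m : ℕ ↦ PowerSeries.coeff m ((1 : PowerSeries ℂ) - PowerSeries.X ^ 2) * z ^ m) (1 - z ^ 2) := by
    have h0 : ∀ m ∉ ({0, 2} : Finset ℕ), PowerSeries.coeff m ((1 : PowerSeries ℂ) - PowerSeries.X ^ 2) * z ^ m = 0 := by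
      intro m hm
      simp only [Finset.mem_insert, Finset.mem_singleton, not_or] at hm
      rw [map_sub, PowerSeries.coeff_one, PowerSeries.coeff_X_pow, if_neg hm.1, if_neg hm.2, sub_zero, zero_mul]
    have e : ∑ m ∈ ({0, 2} : Finset ℕ), PowerSeries.coeff m ((1 : PowerSeries ℂ) - PowerSeries.X ^ 2) * z ^ m = 1 - z ^ 2 := by
      rw [Finset.sum_pair (by norm_num : (0 : ℕ) ≠ 2)]
      simp only [map_sub, PowerSeries.coeff_one, PowerSeries.coeff_X_pow]
      norm_num
      ring
    have h : HasSum (fun m : ℕ ↦ PowerSeries.coeff m ((1 : PowerSeries ℂ) - PowerSeries.X ^ 2) * z ^ m)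
        (∑ m ∈ ({0, 2} : Finset ℕ), PowerSeries.coeff m ((1 : PowerSeries ℂ) - PowerSeries.X ^ 2) * z ^ m) :=
      hasSum_sum_of_ne_finset_zero h0
    rwa [e] at h
  have h3 := h1.unique h2
  have hPz : Polynomial.eval z (∏ i, (1 - Polynomial.C (2 * (Real.cos (φ i) : ℂ)) * Polynomial.X + Polynomial.X ^ 2)) =
      ∏ i, ((1 - cexp (φ i * I) * z) * (1 - cexp (-(φ i) * I) * z)) := by
    rw [Polynomial.eval_prod]
    refine Finset.prod_congr rfl fun i _ ↦ ?_
    rw [one_sub_exp_mul_mul_one_sub_exp_neg_mul]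
    simp only [Polynomial.eval_mul, Polynomial.eval_add, Polynomial.eval_sub, Polynomial.eval_one, Polynomial.eval_C,
      Polynomial.eval_X, Polynomial.eval_pow]
  have hne := prod_one_sub_exp_mul_ne_zero φ hz
  rw [hPz] at h3
  have h4 : ∑' k : ℕ, (sphereHarmonicCharacter (n + 1) k (fun i ↦ Real.cos (φ i)) : ℂ) * z ^ k =
      (1 - z ^ 2) / ∏ i, ((1 - cexp (φ i * I) * z) * (1 - cexp (-(φ i) * I) * z)) := by
    rw [eq_div_iff hne, mul_comm]
    exact h3
  rw [← h4]
  exact hs.of_norm.hasSum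

/-- `e^{i·(2πlp/q)} = γ^{lp}`, `γ = e^{2πi/q}`: the real-angle and the complex forms of the torus eigenvalues. [folklore] -/
private theorem exp_ofReal_two_pi_mul_div_mul_I (q l : ℕ) (p : ℤ) :
    cexp (((2 * π * l * p / q : ℝ) : ℂ) * I) = cexp (2 * π * I * l * p / q) ∧
      cexp (-((2 * π * l * p / q : ℝ) : ℂ) * I) = cexp (-(2 * π * I * l * p / q)) := by
  constructor <;> (congr 1; push_cast; ring)

/-- **THEOREM 3.2 (Ikeda–Yamamoto 1979), EVERY DIMENSION**: "Let `L(q : p₀, ⋯, p_n)` be a lens space and `F(z)` the generating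
function associated to the spectrum of `L(q : p₀, ⋯, p_n)` [`F(z) = ∑_k dim E_{k(k+2n)}·z^k`]. Then `F(z)` has the following form on
the domain `{z ∈ ℂ : |z| < 1}`: (3.8) `F(z) = (1/q)∑_{l=0}^{q−1}(1 − z²)/∏_{i=0}^{n}(1 − γ^{pᵢl}z)(1 − γ^{−pᵢl}z)`", `γ = e^{2πi/q}`;
`dim E_{k(k+2n)} = lensSpaceMultiplicity q p k`, `γ^{±pᵢl} = e^{±2πi·lpᵢ/q}` (every `q ≥ 1` and all integer weights; for a lens space the
`pᵢ` are prime to `q`). [cite: IkedaYamamoto1979, Theorem 3.2 (3.8); Ikeda1980, §2 (2.3)] -/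
theorem hasSum_lensSpaceMultiplicity_mul_pow {n : ℕ} (q : ℕ) (hq : q ≠ 0) (p : Fin (n + 1) → ℤ) {z : ℂ} (hz : ‖z‖ < 1) :
    HasSum (fun k : ℕ ↦ (lensSpaceMultiplicity q p k : ℂ) * z ^ k)
      (1 / (q : ℂ) * ∑ l ∈ range q, (1 - z ^ 2) /
        ∏ i, ((1 - cexp (2 * π * I * l * p i / q) * z) * (1 - cexp (-(2 * π * I * l * p i / q)) * z))) := by
  have h := fun l : ℕ ↦ hasSum_sphereHarmonicCharacter_mul_pow (fun i ↦ 2 * π * l * p i / q) hz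
  have hsum : HasSum (fun k : ℕ ↦ 1 / (q : ℂ) * ∑ l ∈ range q,
      (sphereHarmonicCharacter (n + 1) k (fun i ↦ Real.cos (2 * π * l * p i / q)) : ℂ) * z ^ k)
      (1 / (q : ℂ) * ∑ l ∈ range q, (1 - z ^ 2) /
        ∏ i, ((1 - cexp (((2 * π * l * p i / q : ℝ) : ℂ) * I) * z) * (1 - cexp (-((2 * π * l * p i / q : ℝ) : ℂ) * I) * z))) :=
    (hasSum_sum fun l (_ : l ∈ range q) ↦ h l).mul_left (1 / (q : ℂ))
  have e1 : (fun k : ℕ ↦ (lensSpaceMultiplicity q p k : ℂ) * z ^ k) = fun k : ℕ ↦ 1 / (q : ℂ) * ∑ l ∈ range q,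
      (sphereHarmonicCharacter (n + 1) k (fun i ↦ Real.cos (2 * π * l * p i / q)) : ℂ) * z ^ k := by
    funext k
    rw [show (lensSpaceMultiplicity q p k : ℂ) = ((lensSpaceMultiplicity q p k : ℝ) : ℂ) by norm_cast,
      lensSpaceMultiplicity_eq_sum_sphereHarmonicCharacter q hq p k]
    push_cast
    rw [mul_assoc, Finset.sum_mul]
  have e2 : ∑ l ∈ range q, (1 - z ^ 2) /
        ∏ i, ((1 - cexp (((2 * π * l * p i / q : ℝ) : ℂ) * I) * z) * (1 - cexp (-((2 * π * l * p i / q : ℝ) : ℂ) * I) * z)) =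
      ∑ l ∈ range q, (1 - z ^ 2) /
        ∏ i, ((1 - cexp (2 * π * I * l * p i / q) * z) * (1 - cexp (-(2 * π * I * l * p i / q)) * z)) := by
    refine Finset.sum_congr rfl fun l _ ↦ ?_
    congr 1
    refine Finset.prod_congr rfl fun i _ ↦ ?_
    rw [(exp_ofReal_two_pi_mul_div_mul_I q l (p i)).1, (exp_ofReal_two_pi_mul_div_mul_I q l (p i)).2]
  rw [e1, ← e2]
  exact hsum

/-- The generating function as the sum of its power series: `∑_k dim E_{k(k+2n)}z^k = (3.8)` on the unit disc.
[cite: IkedaYamamoto1979, Theorem 3.2 (3.8)] -/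
theorem tsum_lensSpaceMultiplicity_mul_pow {n : ℕ} (q : ℕ) (hq : q ≠ 0) (p : Fin (n + 1) → ℤ) {z : ℂ} (hz : ‖z‖ < 1) :
    ∑' k : ℕ, (lensSpaceMultiplicity q p k : ℂ) * z ^ k =
      1 / (q : ℂ) * ∑ l ∈ range q, (1 - z ^ 2) /
        ∏ i, ((1 - cexp (2 * π * I * l * p i / q) * z) * (1 - cexp (-(2 * π * I * l * p i / q)) * z)) :=
  (hasSum_lensSpaceMultiplicity_mul_pow q hq p hz).tsum_eq

/-- `F(z) = ∑_k dim E_{k(k+2n)}·z^k` converges absolutely on the unit disc (nonnegative integer coefficients; at `|z|` it is (3.8)).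
[cite: IkedaYamamoto1979, Theorem 3.2] -/
theorem summable_norm_lensSpaceMultiplicity_mul_pow {n : ℕ} (q : ℕ) (hq : q ≠ 0) (p : Fin (n + 1) → ℤ) {z : ℂ} (hz : ‖z‖ < 1) :
    Summable fun k : ℕ ↦ ‖(lensSpaceMultiplicity q p k : ℂ) * z ^ k‖ := by
  have h := (hasSum_lensSpaceMultiplicity_mul_pow q hq p (z := ((‖z‖ : ℝ) : ℂ))
    (by rwa [Complex.norm_real, Real.norm_of_nonneg (norm_nonneg z)])).summable
  have e : (fun k : ℕ ↦ (lensSpaceMultiplicity q p k : ℂ) * ((‖z‖ : ℝ) : ℂ) ^ k) =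
      fun k : ℕ ↦ (((lensSpaceMultiplicity q p k : ℝ) * ‖z‖ ^ k : ℝ) : ℂ) := by
    funext k
    push_cast
    ring
  rw [e, Complex.summable_ofReal] at h
  refine h.congr fun k ↦ ?_
  rw [norm_mul, norm_pow, Complex.norm_natCast]

/-- **PROPOSITION 3.1 (Ikeda–Yamamoto 1979), every dimension**: "The lens space `L(q : p₀, ⋯, p_n)` is isospectral to `L(q' : p'₀,
⋯, p'_n)` if and only if `F(z) = E(z)`" — the two spectra (= the two multiplicity functions `k ↦ dim E_{k(k+2n)}`, Corollary 2.3)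
coincide iff the two generating functions (3.8) coincide on the unit disc (uniqueness of Taylor coefficients).
[cite: IkedaYamamoto1979, Proposition 3.1 (3.7)] -/
theorem lensSpaceMultiplicity_eq_iff_generatingFunction_eq {n : ℕ} (q q' : ℕ) (hq : q ≠ 0) (hq' : q' ≠ 0)
    (p p' : Fin (n + 1) → ℤ) :
    (∀ k : ℕ, lensSpaceMultiplicity q p k = lensSpaceMultiplicity q' p' k) ↔
      ∀ z : ℂ, ‖z‖ < 1 →
        1 / (q : ℂ) * ∑ l ∈ range q, (1 - z ^ 2) /
            ∏ i, ((1 - cexp (2 * π * I * l * p i / q) * z) * (1 - cexp (-(2 * π * I * l * p i / q)) * z)) =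
          1 / (q' : ℂ) * ∑ l ∈ range q', (1 - z ^ 2) /
            ∏ i, ((1 - cexp (2 * π * I * l * p' i / q') * z) * (1 - cexp (-(2 * π * I * l * p' i / q')) * z)) := by
  constructor
  · intro h z hz
    rw [← tsum_lensSpaceMultiplicity_mul_pow q hq p hz, ← tsum_lensSpaceMultiplicity_mul_pow q' hq' p' hz]
    exact tsum_congr fun k ↦ by rw [h k]
  · intro h
    have key := eq_of_tsum_mul_pow_eq (fun z hz ↦ summable_norm_lensSpaceMultiplicity_mul_pow q hq p hz)
      (fun z hz ↦ summable_norm_lensSpaceMultiplicity_mul_pow q' hq' p' hz) fun z hz ↦ by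
        rw [tsum_lensSpaceMultiplicity_mul_pow q hq p hz, tsum_lensSpaceMultiplicity_mul_pow q' hq' p' hz, h z hz]
    intro k
    have hk := congrFun key k
    exact_mod_cast hk

/-! ### §3 `F` is meromorphic with poles only at `q`-th roots of unity; the pole of order `2n+1` at `z = 1`:
`lim_{z→1}(1−z)^{2n+1}F(z) = 2/q` (3.11); Corollary 3.3: the spectrum determines `q` -/

/-- `γ^{lp}` is a `q`-th root of unity: `(e^{2πi·lp/q})^q = 1`, and so is `γ^{−lp}`. [folklore] -/
private theorem exp_two_pi_mul_div_pow_eq_one (q : ℕ) (hq : q ≠ 0) (l : ℕ) (p : ℤ) :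
    cexp (2 * π * I * l * p / q) ^ q = 1 ∧ cexp (-(2 * π * I * l * p / q)) ^ q = 1 := by
  have hq0 : (q : ℂ) ≠ 0 := Nat.cast_ne_zero.mpr hq
  have key : cexp (2 * π * I * l * p / q) ^ q = 1 := by
    rw [← Complex.exp_nat_mul, ← mul_div_assoc, mul_div_cancel_left₀ _ hq0,
      show (2 * π * I * l * p : ℂ) = ((l * p : ℤ) : ℂ) * (2 * π * I) by push_cast; ring]
    exact Complex.exp_int_mul_two_pi_mul_I (l * p)
  refine ⟨key, ?_⟩
  rw [Complex.exp_neg, inv_pow, key, inv_one]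

/-- `1 − ωz ≠ 0` when `ω^q = 1` and `z^q ≠ 1`. [folklore] -/
private theorem one_sub_mul_ne_zero_of_pow_eq_one {ω z : ℂ} {q : ℕ} (hω : ω ^ q = 1) (hz : z ^ q ≠ 1) : 1 - ω * z ≠ 0 := by
  intro h
  have h1 : ω * z = 1 := (sub_eq_zero.mp h).symm
  have h2 := congrArg (· ^ q) h1
  simp only [mul_pow, hω, one_mul, one_pow] at h2
  exact hz h2

/-- "`F(z)` can be considered as a meromorphic function on the whole complex plane `ℂ`. Any pole of `F(z)` is an `q`-th root of one":
the closed form (3.8) is a rational function of `z`, complex-differentiable at every `z` with `z^q ≠ 1` (its denominators `1 − γ^{±pᵢl}z`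
vanish only at `q`-th roots of unity). [cite: IkedaYamamoto1979, §3, proof of Corollary 3.3 (p. 453)] -/
theorem differentiableAt_lensSpaceGeneratingFunction {n : ℕ} (q : ℕ) (hq : q ≠ 0) (p : Fin (n + 1) → ℤ) {z : ℂ} (hz : z ^ q ≠ 1) :
    DifferentiableAt ℂ (fun z : ℂ ↦ 1 / (q : ℂ) * ∑ l ∈ range q, (1 - z ^ 2) /
        ∏ i, ((1 - cexp (2 * π * I * l * p i / q) * z) * (1 - cexp (-(2 * π * I * l * p i / q)) * z))) z := by
  refine (DifferentiableAt.fun_sum fun l _ ↦ ?_).const_mul _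
  have hD : ∏ i, ((1 - cexp (2 * π * I * l * p i / q) * z) * (1 - cexp (-(2 * π * I * l * p i / q)) * z)) ≠ 0 :=
    Finset.prod_ne_zero_iff.mpr fun i _ ↦
      mul_ne_zero (one_sub_mul_ne_zero_of_pow_eq_one (exp_two_pi_mul_div_pow_eq_one q hq l (p i)).1 hz)
        (one_sub_mul_ne_zero_of_pow_eq_one (exp_two_pi_mul_div_pow_eq_one q hq l (p i)).2 hz)
  fun_prop (disch := exact hD)

/-- For `0 < l < q` and `p` prime to `q`: `γ^{lp} ≠ 1` and `γ^{−lp} ≠ 1` (`q ∤ lp`; `two_pi_mul_div_ne_of_isCoprime`). [folklore] -/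
private theorem exp_two_pi_mul_div_ne_one {q : ℕ} {p : ℤ} (hp : IsCoprime p q) {l : ℕ} (hl : 0 < l) (hlq : l < q) :
    cexp (2 * π * I * l * p / q) ≠ 1 ∧ cexp (-(2 * π * I * l * p / q)) ≠ 1 := by
  have key : cexp (2 * π * I * l * p / q) ≠ 1 := by
    intro h
    obtain ⟨m, hm⟩ := Complex.exp_eq_one_iff.mp h
    have e : ((2 * π * l * p / q : ℝ) : ℂ) * I = ((2 * π * m : ℝ) : ℂ) * I := by
      rw [show ((2 * π * l * p / q : ℝ) : ℂ) * I = 2 * π * I * l * p / q by push_cast; ring, hm]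
      push_cast
      ring
    have e2 := mul_right_cancel₀ I_ne_zero e
    exact two_pi_mul_div_ne_of_isCoprime hp hl hlq m (by exact_mod_cast e2)
  refine ⟨key, fun h ↦ key ?_⟩
  rwa [Complex.exp_neg, inv_eq_one] at h

/-- **(3.11) (Ikeda–Yamamoto 1979), EVERY DIMENSION**: "`F(z)` has a pole of order `(2n+1)` at `z = 1`, and
`lim_{z→1}(1−z)^{2n+1}F(z) = 2/q`" — for the closed form (3.8) of the lens space `L(q : p₀, …, p_n)` (`pᵢ` prime to `q`),
`(1−z)^{2n+1}F(z) → 2/q` as `z → 1`, `z ≠ 1`: only the term `l = 0` (`g^l = 1`, denominator `(1−z)^{2n+2}`) has a pole of order `2n+1`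
at `z = 1`; for `0 < l < q` the denominators do not vanish at `1`. [cite: IkedaYamamoto1979, §3 (3.11)] -/
theorem tendsto_one_sub_pow_mul_lensSpaceGeneratingFunction {n : ℕ} (q : ℕ) (hq : q ≠ 0) {p : Fin (n + 1) → ℤ}
    (hp : ∀ i, IsCoprime (p i) q) :
    Tendsto (fun z : ℂ ↦ (1 - z) ^ (2 * n + 1) * (1 / (q : ℂ) * ∑ l ∈ range q, (1 - z ^ 2) /
        ∏ i, ((1 - cexp (2 * π * I * l * p i / q) * z) * (1 - cexp (-(2 * π * I * l * p i / q)) * z))))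
      (𝓝[≠] 1) (𝓝 (2 / (q : ℂ))) := by
  obtain ⟨q', rfl⟩ : ∃ q', q = q' + 1 := ⟨q - 1, (Nat.sub_add_cancel (Nat.one_le_iff_ne_zero.mpr hq)).symm⟩
  -- the terms `0 < l` (shifted: `l + 1`, `l < q'`) are continuous at `z = 1`
  have hcont : ∀ l ∈ range q', ContinuousAt (fun z : ℂ ↦ (1 - z ^ 2) /
      ∏ i, ((1 - cexp (2 * π * I * ((l + 1 : ℕ) : ℂ) * p i / ((q' + 1 : ℕ) : ℂ)) * z) *
        (1 - cexp (-(2 * π * I * ((l + 1 : ℕ) : ℂ) * p i / ((q' + 1 : ℕ) : ℂ))) * z))) 1 := by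
    intro l hl
    have hl' : l + 1 < q' + 1 := Nat.succ_lt_succ (mem_range.mp hl)
    have hD : ∏ i, ((1 - cexp (2 * π * I * ((l + 1 : ℕ) : ℂ) * p i / ((q' + 1 : ℕ) : ℂ)) * 1) *
        (1 - cexp (-(2 * π * I * ((l + 1 : ℕ) : ℂ) * p i / ((q' + 1 : ℕ) : ℂ))) * 1)) ≠ 0 := by
      refine Finset.prod_ne_zero_iff.mpr fun i _ ↦ ?_
      have h₁ := exp_two_pi_mul_div_ne_one (hp i) (Nat.succ_pos l) hl'
      simp only [mul_one]
      exact mul_ne_zero (sub_ne_zero.mpr h₁.1.symm) (sub_ne_zero.mpr h₁.2.symm)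
    exact ContinuousAt.div (by fun_prop) (by fun_prop) hD
  -- the limit of the regularised expression
  have ht1 : Tendsto (fun z : ℂ ↦ (1 - z) ^ (2 * n + 1)) (𝓝[≠] (1 : ℂ)) (𝓝 0) := by
    have h : Tendsto (fun z : ℂ ↦ (1 - z) ^ (2 * n + 1)) (𝓝 1) (𝓝 ((1 - 1) ^ (2 * n + 1))) :=
      (tendsto_const_nhds.sub tendsto_id).pow (2 * n + 1)
    rw [sub_self, zero_pow (Nat.succ_ne_zero _)] at h
    exact h.mono_left nhdsWithin_le_nhds
  have ht2 := tendsto_finsetSum (range q') fun l hl ↦ ((hcont l hl).tendsto.mono_left (nhdsWithin_le_nhds (s := {(1 : ℂ)}ᶜ)))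
  have ht3 : Tendsto (fun z : ℂ ↦ 1 + z) (𝓝[≠] (1 : ℂ)) (𝓝 2) := by
    have h : Tendsto (fun z : ℂ ↦ 1 + z) (𝓝 1) (𝓝 (1 + 1)) := tendsto_const_nhds.add tendsto_id
    rw [one_add_one_eq_two] at h
    exact h.mono_left nhdsWithin_le_nhds
  have hlim := ((ht1.mul ht2).add ht3).const_mul (1 / ((q' + 1 : ℕ) : ℂ))
  rw [zero_mul, zero_add, show 1 / ((q' + 1 : ℕ) : ℂ) * 2 = 2 / ((q' + 1 : ℕ) : ℂ) by ring] at hlim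
  refine hlim.congr' ?_
  filter_upwards [self_mem_nhdsWithin] with z hz
  have hz1 : (1 : ℂ) - z ≠ 0 := sub_ne_zero.mpr (Ne.symm hz)
  -- the term `l = 0`: `(1 − z²)/((1 − z)(1 − z))^{n+1} = (1 + z)/(1 − z)^{2n+1}`
  have key : (1 + z : ℂ) = (1 - z) ^ (2 * n + 1) * ((1 - z ^ 2) / ∏ _i : Fin (n + 1), ((1 - z) * (1 - z))) := by
    rw [Finset.prod_const, Finset.card_univ, Fintype.card_fin, ← pow_two, ← pow_mul,
      show (1 : ℂ) - z ^ 2 = (1 + z) * (1 - z) by ring]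
    have h2n : (1 - z : ℂ) ^ (2 * (n + 1)) = (1 - z) ^ (2 * n + 1) * (1 - z) := by
      ring
    rw [h2n]
    field_simp
  rw [Finset.sum_range_succ']
  simp only [Nat.cast_zero, mul_zero, zero_mul, zero_div, neg_zero, Complex.exp_zero, one_mul]
  rw [key]
  ring

/-- **(3.11) for the power series itself, every dimension**: `(1−z)^{2n+1}·∑_k dim E_{k(k+2n)}z^k → 2/q` as `z → 1` inside the unit disc
(where the series converges and equals (3.8)). [cite: IkedaYamamoto1979, Theorem 3.2, (3.11)] -/
theorem tendsto_one_sub_pow_mul_tsum_lensSpaceMultiplicity_mul_pow {n : ℕ} (q : ℕ) (hq : q ≠ 0) {p : Fin (n + 1) → ℤ}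
    (hp : ∀ i, IsCoprime (p i) q) :
    Tendsto (fun z : ℂ ↦ (1 - z) ^ (2 * n + 1) * ∑' k : ℕ, (lensSpaceMultiplicity q p k : ℂ) * z ^ k)
      (𝓝[Metric.ball 0 1] 1) (𝓝 (2 / (q : ℂ))) := by
  have hle : 𝓝[Metric.ball (0 : ℂ) 1] (1 : ℂ) ≤ 𝓝[≠] 1 :=
    nhdsWithin_mono _ fun z hz (h1 : z = 1) ↦ by
      rw [h1, mem_ball_zero_iff, norm_one] at hz
      exact lt_irrefl _ hz
  refine ((tendsto_one_sub_pow_mul_lensSpaceGeneratingFunction q hq hp).mono_left hle).congr' ?_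
  filter_upwards [self_mem_nhdsWithin] with z hz
  rw [tsum_lensSpaceMultiplicity_mul_pow q hq p (mem_ball_zero_iff.mp hz)]

/-- **COROLLARY 3.3 (Ikeda–Yamamoto 1979), EVERY DIMENSION AND EVERY `q`**: "Assume `L(q : p₀, ⋯, p_n)` is isospectral to `L(q' : p'₀,
⋯, p'_n)`. Then we have `q = q'`" — if `L(q : p₀, …, p_n)` and `L(q' : p'₀, …, p'_n)` (`pᵢ` prime to `q`, `pᵢ'` prime to `q'`) have the
same multiplicities `dim E_{k(k+2n)}` for every `k` (Corollary 2.3: the same spectrum), then `q = q'` (the order of the fundamental group,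
equivalently the volume `Vol(S^{2n+1})/q`, is heard); the printed proof: the generating functions coincide (Proposition 3.1) and (3.11).
[cite: IkedaYamamoto1979, Corollary 3.3] -/
theorem eq_of_lensSpaceMultiplicity_eq {n : ℕ} {q q' : ℕ} (hq : q ≠ 0) (hq' : q' ≠ 0) {p p' : Fin (n + 1) → ℤ}
    (hp : ∀ i, IsCoprime (p i) q) (hp' : ∀ i, IsCoprime (p' i) q')
    (h : ∀ k : ℕ, lensSpaceMultiplicity q p k = lensSpaceMultiplicity q' p' k) : q = q' := by
  have h1 := tendsto_one_sub_pow_mul_tsum_lensSpaceMultiplicity_mul_pow q hq hp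
  have h2 := tendsto_one_sub_pow_mul_tsum_lensSpaceMultiplicity_mul_pow q' hq' hp'
  simp only [← h] at h2
  haveI : (𝓝[Metric.ball (0 : ℂ) 1] (1 : ℂ)).NeBot := mem_closure_iff_nhdsWithin_neBot.mp (by
    rw [closure_ball (0 : ℂ) one_ne_zero, Metric.mem_closedBall, dist_zero_right, norm_one])
  have e := tendsto_nhds_unique h1 h2
  rw [div_eq_div_iff (Nat.cast_ne_zero.mpr hq) (Nat.cast_ne_zero.mpr hq')] at e
  have e2 := mul_left_cancel₀ two_ne_zero e
  exact_mod_cast e2.symm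

end Literature.Analysis.InnerProduct
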